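import Summits.ResolutionOfSingularities.ResolutionOfSingularities.Theorems.MarkedTransferCampaignW46MohWindowSurfaceProof
import HarnessLib

/-!
# [OURS · L1 W4.6 rung (iii-2), piece (T)] THE RÉSUMÉ-FREE FORM: every §2.1-permissible blow-up sequence inside the tame surface Moh
# window is finite — `CampaignW46.MohWindowSurfaceTamePermissiblyTerminates` (cell res-hironaka, LADDER-RESOLUTION rung L, D-0089; unit
# res-L1-s46-pv-12 carried by res-D-pv-050; host MarkedTransfer, `--supports stmt-ResolutionOfSingularities-16155 --as helper`)

HONEST FRAMING. Nothing here is a statement of H. Hironaka's manuscript [Hironaka2017] and nothing here asserts that any statement of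
it holds. The companion `…MohWindowSurfaceProof.lean` proved res-L1-type-o1's typed rung `MohWindowSurfaceTameTerminates` (no infinite
run of the TYPED Th. 16.6 procedure, every `N`, `Rd`); the descent used of a step only its blow-up structure and that the centre is a
point of `Sing(E)`. This file records the same argument for res-L1-s46-pv-1's RÉSUMÉ-FREE `PermissibleRun` (any §2.1-permissible centre —
in the regime a single closed point of `Sing(E)`, `IsPermissibleCentre.exists_eq_singleton_of_isolatedSing`): the multiset of residual
orders drops in the Dershowitz–Manna order at every permissible blow-up whose source and target states lie in
`Regime.mohWindowSurfaceTame`, whence o1's OPTIONAL (strongest) target `mohWindowSurfaceTamePermissiblyTerminates_holds` (§5) and its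
perfect-field slice; the typed forms follow again by `mohWindowSurfaceTameTerminates_of_permissibly`. AI-written; AI review is weaker than
expert review. No `sorry`; axioms standard. [folklore]
-/

noncomputable section

set_option linter.dupNamespace false -- mandated namespace of this single-conjunct summit

open CategoryTheory AlgebraicGeometry TopologicalSpace IsLocalRing

namespace Summit.ResolutionOfSingularities.ResolutionOfSingularities.Theorems

namespace CampaignW46

open Literature.AlgebraicGeometry.Resolution
open Literature.AlgebraicGeometry.Hironaka2017.S02Preliminaries
open Literature.AlgebraicGeometry.Hironaka2017.Datum
open Literature.AlgebraicGeometry.Hironaka2017.S16Proof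
open Scheme.IdealSheafData
open Polynomial

universe u

namespace MohWindowSurfacePermissible

variable {p : ℕ} [Fact p.Prime] {K : Type u} [Field K] [CharP K p]
variable {A A' : AmbientDatum p K} {E : IdealExponent A.Z}

/-- **[OURS · L1 W4.6 rung (iii-2)] THE DROP OVER THE CENTRE.** For a step `s` of the typed procedure from a state in the tame
surface window with transform again in the tame surface window, at every singular point `ξ′` of `E′` lying over the centre the
residual order of `J′_{ξ′}` is strictly smaller than that of `J_{π ξ′}`. NOT a statement of the manuscript. [folklore] -/
theorem residualOrder_lt_of_over_centre {D : Closeds A.Z} (π : A'.Z ⟶ A.Z) (hπ : IsBlowup π (vanishingIdeal D))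
    (hD : E.IsPermissibleCentre A.hom D) (hRg : Regime.mohWindowSurfaceTame A E)
    (hRg' : Regime.mohWindowSurfaceTame A' (E.transform π D)) {x' : A'.Z} (hx' : x' ∈ (E.transform π D).sing)
    (hover : π.base x' ∈ (D : Set A.Z)) :
    (residualOrder (E.transform π D).b (A'.Z.presheaf.stalk x') (stalkIdeal (E.transform π D).J x')).toNat <
      (residualOrder E.b (A.Z.presheaf.stalk (π.base x')) (stalkIdeal E.J (π.base x'))).toNat := by
  classical
  obtain ⟨ξ, hξS, hξcl, hDξ⟩ := IsPermissibleCentre.exists_eq_singleton_of_isolatedSing hD ⟨hRg.2.1, hRg.2.2.1⟩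
  have hπx : π.base x' = ξ := by simpa [hDξ] using hover
  obtain ⟨hb, -, -, hwin⟩ := hRg
  obtain ⟨-, -, -, hwin'⟩ := hRg'
  have hbE' : (E.transform π D).b = E.b := rfl
  haveI : IsLocallyNoetherian A'.Z := by
    haveI := A'.smooth
    exact LocallyOfFiniteType.isLocallyNoetherian A'.hom
  have hp1 : 1 ≤ p := (Fact.out : p.Prime).one_lt.le
  -- the tame presentation downstairs, at `π x' = ξ`
  obtain ⟨hRreg, h3, x, y, z, hxyz, d, a, hbd, hd2, hunit, hJ, htx, hty⟩ := hwin _ (hπx ▸ hξS)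
  rw [hb] at hbd hd2 hJ htx hty
  haveI := hRreg
  -- the tame presentation upstairs, at `x'`
  obtain ⟨hLreg, h3L, x₁, y₁, z₁, hxyz₁, d₁, a₁, hbd₁, hd2₁, hunit₁, hJ₁, -, -⟩ := hwin' _ hx'
  rw [hbE', hb] at hbd₁ hd2₁ hJ₁
  haveI := hLreg
  haveI : CharP (A.Z.presheaf.stalk (π.base x')) p := Lem16p11Proof.charP_stalk A (𝟙 A.Z) _
  haveI : CharP (A'.Z.presheaf.stalk x') p := Lem16p11Proof.charP_stalk A π x'
  -- both residual orders are the exponents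
  rw [hbE', hb, hJ, hJ₁, MohWindowSurface.residualOrder_coeff p hLreg h3L hxyz₁ hbd₁ hd2₁ hunit₁,
    MohWindowSurface.residualOrder_coeff p hRreg h3 hxyz hbd hd2 hunit, ENat.toNat_coe, ENat.toNat_coe]
  -- the Rees chart at `x'`
  set c : Fin 3 → A.Z.presheaf.stalk (π.base x') := ![x, y, z] with hc_def
  have hc : Ideal.span (Set.range c) = maximalIdeal _ := by rw [hc_def, MohWindowSurface.range_vec3]; exact hxyz
  have hY : stalkIdeal (vanishingIdeal D) (π.base x') = maximalIdeal (A.Z.presheaf.stalk (π.base x')) := by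
    apply stalkIdeal_vanishingIdeal_eq_maximalIdeal_of_closure_eq
    rw [hDξ, hπx, hξcl.closure_eq]
  have hcY : Ideal.span (Set.range c) = stalkIdeal (vanishingIdeal D) (π.base x') := hc.trans hY.symm
  obtain ⟨j, 𝔴, χ, hχ, hloc, h𝔴⟩ := hπ.exists_reesChart_stalk x' c hcY
  letI := χ.toAlgebra
  haveI : IsLocalization.AtPrime (A'.Z.presheaf.stalk x') 𝔴.asIdeal := hloc
  set ψ : A.Z.presheaf.stalk (π.base x') →+* A'.Z.presheaf.stalk x' := (π.stalkMap x').hom with hψ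
  have hψa : ∀ r, ψ r = (algebraMap (chartRing c j) (A'.Z.presheaf.stalk x') :
      chartRing c j →+* A'.Z.presheaf.stalk x') (chartBase c j r) := fun r => (hχ r).symm
  have hrel : ∀ l, ψ (c l) = ψ (c j) * χ (chartGen c j l) := stalkMap_apply_eq_mul_chartGen j χ hχ
  -- the stalk of the transform is the colon `((ψ g) : (ψ c_j)^p)`
  have hCmap : (stalkIdeal (vanishingIdeal D) (π.base x')).map ψ = Ideal.span {ψ (c j)} := by
    rw [← hcY, Ideal.map_span_range_eq_span_singleton _ c j _ hrel]
  have hstalk : stalkIdeal (E.transform π D).J x' =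
      Submodule.colon (Ideal.span {ψ (z ^ p + ∑ k ∈ Finset.range (d + 1), a k * x ^ (d - k) * y ^ k)})
        ((Ideal.span {ψ (c j)} ^ p : Ideal _) : Set _) := by
    show stalkIdeal (controlledTransform π (vanishingIdeal D) E.J E.b) x' = _
    rw [controlledTransform, stalkIdeal_colon, stalkIdeal_pow, stalkIdeal_comap_eq_map_stalkMap,
      stalkIdeal_comap_eq_map_stalkMap, ← hψ, hCmap, hJ, Ideal.map_span, Set.image_singleton, hb]
  have hx'sing : stalkIdeal (E.transform π D).J x' ≤ maximalIdeal _ ^ p := by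
    have := (le_idealOrder_iff (E.transform π D).J x' (E.transform π D).b).mp hx'
    rwa [hbE', hb] at this
  have hcj : ψ (c j) ∈ maximalIdeal _ := by
    rw [hψa]
    exact (IsLocalization.AtPrime.to_map_mem_maximal_iff _ 𝔴.asIdeal _).mpr
      (by rw [← Ideal.mem_comap, h𝔴, ← hc]; exact Ideal.subset_span ⟨j, rfl⟩)
  haveI : IsDomain (A'.Z.presheaf.stalk x') := isDomain_of_isRegularLocalRing _
  -- which chart?
  obtain rfl | rfl | rfl : j = 0 ∨ j = 1 ∨ j = 2 := by
    rcases j with ⟨j, hj⟩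
    have : j = 0 ∨ j = 1 ∨ j = 2 := by omega
    rcases this with rfl | rfl | rfl
    · exact Or.inl rfl
    · exact Or.inr (Or.inl rfl)
    · exact Or.inr (Or.inr rfl)
  · -- chart `x`: free letter `y`, `u k = min k d`, tameness `tame_x`
    have htx' : ∀ τ : ResidueField (A.Z.presheaf.stalk (π.base x')), ¬ (X - C τ) ^ p ∣
        ∑ k ∈ Finset.range (d + 1), C (residue _ (a k)) * X ^ (min k d) := by
      intro τ; rw [← residue_sum_chart_zero]; exact htx τ
    refine MohWindowSurface.exponent_lt_of_chart p h3 c hc (i := 0) (i' := 1) (by decide) (by decide) (by decide) hbd hd2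
      a (fun k => min k d) (fun k => min_le_right k d) htx' 𝔴.asIdeal h𝔴 _ h3L ψ hψa (I' := stalkIdeal (E.transform π D).J x') ?_
      hx'sing hxyz₁ hbd₁ a₁ hJ₁
    rw [hstalk, window_sum_chart_zero]
    rfl
  · -- chart `y`: free letter `x`, `u k = d - k`, tameness `tame_y`
    refine MohWindowSurface.exponent_lt_of_chart p h3 c hc (i := 1) (i' := 0) (by decide) (by decide) (by decide) hbd hd2
      a (fun k => d - k) (fun k => Nat.sub_le d k) hty 𝔴.asIdeal h𝔴 _ h3L ψ hψa (I' := stalkIdeal (E.transform π D).J x') ?_ hx'sing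
      hxyz₁ hbd₁ a₁ hJ₁
    rw [hstalk, window_sum_chart_one]
    rfl
  · -- chart `z`: the cofactor is a unit, the transform is the unit ideal — `x'` would not be singular
    exfalso
    have hfac := MohWindowSurface.map_window_eq_chart_two ψ (hrel 0) (hrel 1) hbd.le a (d := d)
    have hunit2 := MohWindowSurface.isUnit_chart_two_cofactor hcj hbd
      (S := ∑ k ∈ Finset.range (d + 1), ψ (a k) * χ (chartGen c 2 0) ^ (d - k) * χ (chartGen c 2 1) ^ k)
    have hne : ψ (c 2) ≠ 0 := by
      have hz0 : Ideal.span (Set.range (Fin.append c (fun k : Fin 0 => Fin.elim0 k : Fin 0 → _))) = maximalIdeal _ := by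
        rw [MohWindowSurface.span_range_append_elim0]; exact hc
      have hd0 : (maximalIdeal (A.Z.presheaf.stalk (π.base x'))).spanFinrank = 3 + 0 := by rw [h3]
      have hrsop := isRsopPart_chartFamily_reesChart c 2 (fun k : Fin 0 => Fin.elim0 k) hz0 hd0 𝔴.asIdeal h𝔴
        (A'.Z.presheaf.stalk x') (a := 0) (fun k : Fin 0 => Fin.elim0 k) (Function.injective_of_subsingleton _)
        (fun k => Fin.elim0 k)
      have h0 := hrsop.ne_zero 0
      rw [hψa]; simpa only [chartFamily, Fin.cons_zero] using h0
    have htop : stalkIdeal (E.transform π D).J x' = ⊤ := by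
      rw [hstalk]
      have : ψ (z ^ p + ∑ k ∈ Finset.range (d + 1), a k * x ^ (d - k) * y ^ k) =
          ψ (c 2) ^ p * (1 + ψ (c 2) ^ (d - p) *
            ∑ k ∈ Finset.range (d + 1), ψ (a k) * χ (chartGen c 2 0) ^ (d - k) * χ (chartGen c 2 1) ^ k) := hfac
      rw [this, MohWindowSurface.colon_span_pow_mul (mem_nonZeroDivisors_of_ne_zero hne), Ideal.span_singleton_eq_top]
      exact hunit2
    have h1 : (1 : A'.Z.presheaf.stalk x') ∈ maximalIdeal _ := by
      have := hx'sing (htop ▸ Submodule.mem_top : (1 : A'.Z.presheaf.stalk x') ∈ stalkIdeal (E.transform π D).J x')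
      exact Ideal.pow_le_self (by omega) this
    exact (maximalIdeal.isMaximal _).ne_top ((Ideal.eq_top_iff_one _).mpr h1)

/-- **Off the centre the residual order is transported**: for `ξ′ ∈ Z′` not over the centre, `π` is an isomorphism on stalks and
`J′_{ξ′} = J_{π ξ′} 𝒪_{ξ′}`, so the residual orders agree. [folklore] -/
theorem residualOrder_eq_of_not_over_centre {D : Closeds A.Z} (π : A'.Z ⟶ A.Z) (hπ : IsBlowup π (vanishingIdeal D))
    {x' : A'.Z} (hover : π.base x' ∉ (D : Set A.Z)) :
    residualOrder (E.transform π D).b (A'.Z.presheaf.stalk x') (stalkIdeal (E.transform π D).J x') =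
      residualOrder E.b (A.Z.presheaf.stalk (π.base x')) (stalkIdeal E.J (π.base x')) := by
  haveI : IsLocallyNoetherian A'.Z := by
    haveI := A'.smooth
    exact LocallyOfFiniteType.isLocallyNoetherian A'.hom
  have hnot : π.base x' ∉ (vanishingIdeal D).support := by
    rw [← SetLike.mem_coe, coe_support_vanishingIdeal]; exact hover
  have h1 : stalkIdeal (E.transform π D).J x' = (stalkIdeal E.J (π.base x')).map (π.stalkMap x').hom := by
    show stalkIdeal (controlledTransform π (vanishingIdeal D) E.J E.b) x' = _
    rw [hπ.stalkIdeal_controlledTransform_of_not_mem E.J E.b hnot, stalkIdeal_comap_eq_map_stalkMap]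
  haveI := hπ.isIso_stalkMap_of_not_mem_support hnot
  let e : A.Z.presheaf.stalk (π.base x') ≃+* A'.Z.presheaf.stalk x' := (asIso (π.stalkMap x')).commRingCatIsoToRingEquiv
  have he : ((e : A.Z.presheaf.stalk (π.base x') →+* A'.Z.presheaf.stalk x') : _ → _) = (π.stalkMap x').hom := rfl
  have h2 : (stalkIdeal E.J (π.base x')).map (π.stalkMap x').hom =
      (stalkIdeal E.J (π.base x')).map (e : A.Z.presheaf.stalk (π.base x') →+* A'.Z.presheaf.stalk x') := by
    unfold Ideal.map; rw [he]
  rw [h1, h2, show (E.transform π D).b = E.b from rfl, MohWindowSurface.residualOrder_map_ringEquiv]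

/-- Off the centre a singular point of `E′` lies over a singular point of `E` other than the centre point. [folklore] -/
theorem base_mem_sing_of_not_over_centre {D : Closeds A.Z} (π : A'.Z ⟶ A.Z) (hπ : IsBlowup π (vanishingIdeal D))
    {x' : A'.Z} (hx' : x' ∈ (E.transform π D).sing) (hover : π.base x' ∉ (D : Set A.Z)) : π.base x' ∈ E.sing := by
  haveI : IsLocallyNoetherian A'.Z := by
    haveI := A'.smooth
    exact LocallyOfFiniteType.isLocallyNoetherian A'.hom
  have hnot : π.base x' ∉ (vanishingIdeal D).support := by
    rw [← SetLike.mem_coe, coe_support_vanishingIdeal]; exact hover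
  have hx'b : (E.b : ℕ∞) ≤ idealOrder (controlledTransform π (vanishingIdeal D) E.J E.b) x' := hx'
  show (E.b : ℕ∞) ≤ idealOrder E.J (π.base x')
  rw [← hπ.idealOrder_controlledTransform_of_not_mem E.J E.b hnot]
  exact hx'b


/-- **[OURS · L1 W4.6 rung (iii-2)] ONE STEP DROPS THE MULTISET OF RESIDUAL ORDERS** (Dershowitz–Manna): for a step `s` from a state
`(A, E)` of the tame surface window whose transform `(A′, E′)` is again in it, the multiset `{residualOrder J′_{ξ′} : ξ′ ∈ Sing(E′)}` is
`<_DM` `{residualOrder J_ξ : ξ ∈ Sing(E)}`: remove the value at the blown-up point `ξ`, add the (smaller) values at the singular points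
over `ξ`, keep the rest. NOT a statement of the manuscript. [folklore] -/
theorem isDershowitzMannaLT_of_isPermissibleCentre {D : Closeds A.Z} (π : A'.Z ⟶ A.Z)
    (hπ : IsBlowup π (vanishingIdeal D)) (hD : E.IsPermissibleCentre A.hom D) (hRg : Regime.mohWindowSurfaceTame A E)
    (hRg' : Regime.mohWindowSurfaceTame A' (E.transform π D)) :
    Multiset.IsDershowitzMannaLT
      ((hRg'.sing_finite.toFinset.val).map fun ξ' =>
        (residualOrder (E.transform π D).b (A'.Z.presheaf.stalk ξ') (stalkIdeal (E.transform π D).J ξ')).toNat)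
      ((hRg.sing_finite.toFinset.val).map fun ξ =>
        (residualOrder E.b (A.Z.presheaf.stalk ξ) (stalkIdeal E.J ξ)).toNat) := by
  classical
  obtain ⟨ξ, hξS, hξcl, hDξ⟩ := IsPermissibleCentre.exists_eq_singleton_of_isolatedSing hD ⟨hRg.2.1, hRg.2.2.1⟩
  set val : A.Z → ℕ := fun η => (residualOrder E.b (A.Z.presheaf.stalk η) (stalkIdeal E.J η)).toNat with hval
  set val' : A'.Z → ℕ := fun η => (residualOrder (E.transform π D).b (A'.Z.presheaf.stalk η) (stalkIdeal (E.transform π D).J η)).toNat with hval'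
  set S : Finset A.Z := hRg.sing_finite.toFinset with hS
  set S' : Finset A'.Z := hRg'.sing_finite.toFinset with hS'
  set Son : Finset A'.Z := S'.filter fun x' => π.base x' = ξ with hSon
  set Soff : Finset A'.Z := S'.filter fun x' => ¬ π.base x' = ξ with hSoff
  have hξmem : ξ ∈ S := by rw [hS, Set.Finite.mem_toFinset]; exact hξS
  have hmemS' : ∀ x', x' ∈ S' ↔ x' ∈ (E.transform π D).sing := fun x' => by rw [hS', Set.Finite.mem_toFinset]
  -- split `M = X + Y`
  have hsplit : S'.val.map val' = Soff.val.map val' + Son.val.map val' := by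
    rw [← Multiset.map_add, hSoff, hSon, Finset.filter_val, Finset.filter_val, add_comm, Multiset.filter_add_not]
  -- off the centre: `X ≤` the multiset of `E` without the blown-up point
  have hoff : ∀ x' ∈ Soff, π.base x' ∉ (D : Set A.Z) := fun x' hx' => by
    rw [hSoff, Finset.mem_filter] at hx'
    rw [hDξ]; exact hx'.2
  have hinj : Set.InjOn π.base (Soff : Set A'.Z) :=
    (MohWindow.injOn_preimage_compl hπ).mono fun x' hx' => hoff x' hx'
  have himage : Soff.image π.base ⊆ S.erase ξ := by
    intro η hη
    obtain ⟨x', hx', rfl⟩ := Finset.mem_image.mp hη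
    have hx'S : x' ∈ (E.transform π D).sing := (hmemS' x').mp (Finset.mem_filter.mp hx').1
    refine Finset.mem_erase.mpr ⟨?_, ?_⟩
    · have := hoff x' hx'; rw [hDξ] at this; exact this
    · rw [hS, Set.Finite.mem_toFinset]
      exact base_mem_sing_of_not_over_centre π hπ hx'S (hoff x' hx')
  have hXle : Soff.val.map val' ≤ (S.erase ξ).val.map val := by
    have h1 : Soff.val.map val' = (Soff.val.map π.base).map val := by
      rw [Multiset.map_map]
      refine Multiset.map_congr rfl fun x' hx' => ?_
      have hx'' : x' ∈ Soff := hx'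
      simp only [hval, hval', Function.comp_apply]
      rw [residualOrder_eq_of_not_over_centre π hπ (hoff x' hx'')]
    rw [h1, ← Finset.image_val_of_injOn hinj]
    exact Multiset.map_le_map (Finset.val_le_iff.mpr himage)
  have hSval : S.val.map val = (S.erase ξ).val.map val + {val ξ} := by
    conv_lhs => rw [← Finset.insert_erase hξmem]
    rw [Finset.insert_val_of_notMem (Finset.notMem_erase ξ S), Multiset.map_cons, add_comm, Multiset.singleton_add]
  have hXleN : Soff.val.map val' ≤ S.val.map val := by
    rw [hSval]; exact hXle.trans (Multiset.le_add_right _ _)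
  have hZ : S.val.map val - Soff.val.map val' = ((S.erase ξ).val.map val - Soff.val.map val') + {val ξ} := by
    rw [hSval, add_comm ((S.erase ξ).val.map val), add_tsub_assoc_of_le hXle, add_comm]
  refine ⟨Soff.val.map val', Son.val.map val', S.val.map val - Soff.val.map val', ?_, hsplit, ?_, ?_⟩
  · rw [hZ]
    exact fun h => by simpa using congrArg (fun m => val ξ ∈ m) h
  · rw [add_tsub_cancel_of_le hXleN]
  · intro y hy
    obtain ⟨x', hx', rfl⟩ := Multiset.mem_map.mp hy
    have hx'f := Finset.mem_filter.mp hx'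
    have hx'S : x' ∈ (E.transform π D).sing := (hmemS' x').mp hx'f.1
    refine ⟨val ξ, ?_, ?_⟩
    · rw [hZ]; exact Multiset.mem_add.mpr (Or.inr (Multiset.mem_singleton_self _))
    · have hover : π.base x' ∈ (D : Set A.Z) := by rw [hDξ]; exact hx'f.2
      have := residualOrder_lt_of_over_centre π hπ hD hRg hRg' hx'S hover
      rw [hx'f.2] at this
      exact this


/-- **[OURS · L1 W4.6 rung (iii-2)] EVERY PERMISSIBLE BLOW-UP SEQUENCE INSIDE THE TAME SURFACE MOH WINDOW IS FINITE** (résumé-free). NOT a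
statement of the manuscript. [folklore] -/
theorem permissiblyTerminates_mohWindowSurfaceTame :
    PermissiblyTerminates (Regime.mohWindowSurfaceTame (p := p) (K := K)) := by
  intro r hr
  let M : ℕ → Multiset ℕ := fun k =>
    ((hr k).sing_finite.toFinset.val).map fun ξ =>
      (residualOrder (r.E k).b ((r.A k).Z.presheaf.stalk ξ) (stalkIdeal (r.E k).J ξ)).toNat
  have hlt : ∀ k, Multiset.IsDershowitzMannaLT (M (k + 1)) (M k) := by
    intro k
    have key : ∀ (E₁ : IdealExponent (r.A (k + 1)).Z) (h₁ : Regime.mohWindowSurfaceTame (r.A (k + 1)) E₁),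
        E₁ = (r.E k).transform (r.π k) (r.D k) →
        Multiset.IsDershowitzMannaLT
          ((h₁.sing_finite.toFinset.val).map fun ξ =>
            (residualOrder E₁.b ((r.A (k + 1)).Z.presheaf.stalk ξ) (stalkIdeal E₁.J ξ)).toNat)
          (M k) := by
      intro E₁ h₁ heq
      subst heq
      exact isDershowitzMannaLT_of_isPermissibleCentre (r.π k) (r.blowup k) (r.permissible k) (hr k) h₁
    exact key (r.E (k + 1)) (hr (k + 1)) (r.E_succ k)
  exact false_of_descending_chain Multiset.wellFounded_isDershowitzMannaLT M hlt

end MohWindowSurfacePermissible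

/-- [OURS · L1 W4.6 rung (iii-2)] **The résumé-free rung `MohWindowSurfaceTamePermissiblyTerminates` holds** (every prime `p`, every
field `K` of characteristic `p`). [folklore] -/
theorem mohWindowSurfaceTamePermissiblyTerminates_holds (p : ℕ) [Fact p.Prime] (K : Type u) [Field K] [CharP K p] :
    MohWindowSurfaceTamePermissiblyTerminates p K :=
  MohWindowSurfacePermissible.permissiblyTerminates_mohWindowSurfaceTame

/-- [OURS · L1 W4.6 rung (iii-2)] **Its perfect-base-field slice `MohWindowSurfaceTamePermissiblyTerminatesPerfect` holds**. [folklore] -/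
theorem mohWindowSurfaceTamePermissiblyTerminatesPerfect_holds (p : ℕ) [Fact p.Prime] (K : Type u) [Field K] [CharP K p]
    [PerfectField K] : MohWindowSurfaceTamePermissiblyTerminatesPerfect p K :=
  mohWindowSurfaceTamePermissiblyTerminatesPerfect_iff.mpr (mohWindowSurfaceTamePermissiblyTerminates_holds p K)

end CampaignW46

end Summit.ResolutionOfSingularities.ResolutionOfSingularities.Theorems

end
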